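import Literature.NumberTheory.EllipticCurves.KleinFrickeLevelNine
import Literature.NumberTheory.EllipticCurves.ThreeIsogeny
import Literature.NumberTheory.EllipticCurves.XZeroTwentySevenFermat
import HarnessLib

/-!
# Klein–Fricke, level `27`: a rational cyclic `27`-isogeny forces `j = -2¹⁵·3·5³`

Main results (namespace `WeierstrassCurve`):

* `exists_XZeroTwentySeven_of_torsion` — an elliptic curve `W/F` (`char F = 0`), `L/F` Galois,
  `P ∈ W(L)` of order `27` with `Gal(L/F)`-stable `ℤP` ⇒ there are `η, η' ∈ F` with
  `η(η² + 9η + 27) ≠ 0`, `j(W)·η(η² + 9η + 27) = (η + 3)³(η³ + 9η² + 27η + 3)³` and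
  `η'(η'² + 9η' + 27)(η² + 9η + 27) = η³`, a plane model of `X₀(27)` (the fibre product of the two
  degeneracy maps `X₀(9) ⇉ X₀(3)` expressed in the Hauptmoduln `t₉ = η`, `t₃`:
  `t₃ = t₉(t₉² + 9t₉ + 27)` on one side and `t₃ = t₉³/(t₉² + 9t₉ + 27)` on the other — Maier,
  *On rationally parametrized modular equations*, Table 4 and §5);
* `Isogeny.exists_XZeroTwentySeven_of_isCyclic` — the same from a `K`-rational isogeny with cyclic
  kernel of order `27`;
* `Isogeny.j_eq_of_isCyclic_degree_twentySeven` — over `ℚ` this forces `j = -12288000 =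
  -2¹⁵·3·5³` (Kenku's level `27`; the only rational points of the cubic above with `η ≠ 0` are
  `(η, η') = (-9, -3)` by Euler's `n = 3` case of Fermat,
  `Literature.NumberTheory.EllipticCurves.XZeroTwentySeven.rat_point_eq`).

This discharges, without modular curves, the level-`27` entry of the table of rational cyclic
isogenies used by `Summit.ABC.ABC.Theorems.mazurKenkuRadius_of_three` (hypothesis `hT8`, `N = 27`:
`(27, j) ∈ kenkuIsogenyJTable ↔ j = -2¹⁵·3·5³`).

## Method

Let `P` have order `27`, `Q = 3P` (order `9`), `T = 9P` (order `3`); `x(T) ∈ F` since `σT = ±T`.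
After the `F`-rational change of variables `D = (1, x(T), -a₁/2, -(a₃ + a₁x(T))/2)` the curve is
`E₁ = [0, m², 0, 2ms, s²]` with `T ↦ (0, s)` (`m, s ∈ L`, but `a₄ = 2ms`, `a₆ = s²` in `F`), and
Vélu's quotient `E' = E₁/⟨T⟩ = [0, a₂, 0, -9a₄, -(27a₆ + 8a₂a₄)]` is defined over `F`
(`WeierstrassCurve.IsVeluThreePair`, whose `pointHom` is the `3`-isogeny on `L`-points; it is
`Gal(L/F)`-equivariant because its coefficients lie in `F`). The image `P̄` of `P` has order `9`
with stable `ℤP̄`, and `3P̄` is the image of `Q`. Klein–Fricke at level `9`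
(`exists_hauptmodul_nine_eq_of_torsion`, the theorem of `KleinFrickeLevelNine` refined by the
VALUE of the Hauptmodul, `η = (f³ - 6f² + 3f + 1)/(f(f - 1))` in Kubert's coordinate `f` of the
point) applied to `(W, Q)` and `(E', P̄)` gives `η, η' ∈ F` and the `j`-relation. The equation of
`X₀(27)` is the equality of two evaluations of the level-`3` Hauptmodul
`t₃ = A₁³/A₃ - 27` (`TorsionPointHauptmodul`) of `E'` at the `3`-torsion point `3P̄`:
on Kubert's universal family `E_f = [1 - c, -b, -b, 0, 0]`, `c = f²(f - 1)`, `b = c(f² - f + 1)`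
(`tate_parametrisation_nine`) one computes `T = 3P₀ = (v²f²(f-1), v³f³(f-1)²)`,
`t₃(E_f, T) = η(η² + 9η + 27)` (`tau_three_sub_kubert`, the compatibility `X₀(9) → X₀(3)`,
`C₉ ↦ 3C₉`) and, pushing `P₀` through Vélu's formulae for `E_f/⟨T⟩`,
`t₃(E_f/⟨T⟩, P̄₀) = η³/(η² + 9η + 27)` (`tau_three_velu_kubert`, the degeneracy
`X₀(9) → X₀(3)`, `(E, C₉) ↦ (E/3C₉, C₉/3C₉)`); `level_nine_three_smul` transports both to an
arbitrary point of order `9` through the tangent normal form (`TorsionPointNormalForms`) and the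
composition rule `D = D_𝒦 ∘ C_P` for changes of variables (`VariableChange.toX_mul`).
All identities are closed by `ring`/`linear_combination`/`field_simp`; the closed forms were found
with a computer algebra system (compute job `j027562`), on which nothing below depends.

References: R. S. Maier, *On rationally parametrized modular equations*, J. Ramanujan Math. Soc.
24 (2009), arXiv:math/0611041, Table 4 and §5 [cite: Maier2006, Table 4 (N = 9, 27), §5];
D. S. Kubert, *Universal bounds on the torsion of elliptic curves*, Proc. LMS 33 (1976), Table 3
[cite: Kubert1976, Table 3]; J. E. Cremona, *Algorithms for Modular Elliptic Curves*, §3.8 (Vélu)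
[cite: CremonaAlgorithms1997, §3.8]; M. A. Kenku, *On the modular curves X₀(125), X₁(25),
X₁(49)* and *The modular curve X₀(27)* notes, J. London Math. Soc. (2) 23 (1981).
-/

noncomputable section

open scoped Classical

namespace WeierstrassCurve

universe u

variable {F : Type u} [Field F] {W : WeierstrassCurve F}

/-! ### §0. Composition of changes of variables on coordinates -/

/-- `(C C').toX = C.toX ∘ C'.toX` (the product acts by first `C'`, then `C`, as
`(C C') • W = C • (C' • W)`). [folklore] -/
theorem VariableChange.toX_mul (C C' : VariableChange F) (x : F) :
    (C * C').toX x = C.toX (C'.toX x) := by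
  simp only [VariableChange.toX_def, VariableChange.mul_def, Units.val_inv_eq_inv_val,
    Units.val_mul]
  field_simp
  ring

/-- `(C C').toY = C.toY ∘ (C'.toX, C'.toY)`. [folklore] -/
theorem VariableChange.toY_mul (C C' : VariableChange F) (x y : F) :
    (C * C').toY x y = C.toY (C'.toX x) (C'.toY x y) := by
  simp only [VariableChange.toX_def, VariableChange.toY_def, VariableChange.mul_def,
    Units.val_inv_eq_inv_val, Units.val_mul]
  field_simp
  ring

/-! ### §1. Computations on Kubert's family `E_f` (scaled by `v`) -/

section Family

variable {f v : F}

/-- On the member `[a₁, a₂, a₃, 0, 0] = [v(1 - f²(f-1)), -v²f²(f-1)(f²-f+1), -v³f²(f-1)(f²-f+1), 0, 0]`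
of Kubert's `X₁(9)`-family, the point `T = 3P₀ = (a₃(a₃ - a₁a₂)/a₂², -a₃(a₂³ - a₁a₂a₃ + a₃²)/a₂³)`
(`WeierstrassCurve.three_smul_zero_zero`) is `(v²f²(f-1), v³f³(f-1)²)` (Tate's `(c, b - c)·d³`).
[cite: Kubert1976, Table 3 (N = 9)] -/
theorem kubert_three_smul_coord (ha₁ : W.a₁ = v * (1 - f ^ 2 * (f - 1)))
    (ha₂ : W.a₂ = -v ^ 2 * (f ^ 2 * (f - 1) * (f ^ 2 - f + 1)))
    (ha₃ : W.a₃ = -v ^ 3 * (f ^ 2 * (f - 1) * (f ^ 2 - f + 1))) (hv : v ≠ 0) (hf0 : f ≠ 0)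
    (hf1 : f - 1 ≠ 0) (hq : f ^ 2 - f + 1 ≠ 0) :
    W.a₃ * (W.a₃ - W.a₁ * W.a₂) / W.a₂ ^ 2 = v ^ 2 * (f ^ 2 * (f - 1)) ∧
      -(W.a₃ * (W.a₂ ^ 3 - W.a₁ * W.a₂ * W.a₃ + W.a₃ ^ 2)) / W.a₂ ^ 3 =
        v ^ 3 * (f ^ 3 * (f - 1) ^ 2) := by
  have hA : -v ^ 2 * (f ^ 2 * (f - 1) * (f ^ 2 - f + 1)) ≠ 0 :=
    mul_ne_zero (neg_ne_zero.2 (pow_ne_zero 2 hv))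
      (mul_ne_zero (mul_ne_zero (pow_ne_zero 2 hf0) hf1) hq)
  rw [ha₁, ha₂, ha₃]
  constructor
  · rw [div_eq_iff (pow_ne_zero 2 hA)]
    ring
  · rw [div_eq_iff (pow_ne_zero 3 hA)]
    ring

/-- `-T` on Kubert's curve: `ȳ_T = v³f⁴(f-1)²`. [folklore] -/
theorem kubert_negY_three_smul (ha₁ : W.a₁ = v * (1 - f ^ 2 * (f - 1)))
    (ha₃ : W.a₃ = -v ^ 3 * (f ^ 2 * (f - 1) * (f ^ 2 - f + 1))) :
    W.toAffine.negY (v ^ 2 * (f ^ 2 * (f - 1))) (v ^ 3 * (f ^ 3 * (f - 1) ^ 2)) =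
      v ^ 3 * (f ^ 4 * (f - 1) ^ 2) := by
  simp only [Affine.negY]
  rw [ha₁, ha₃]
  ring

/-- **The level-`9` → level-`3` compatibility on Kubert's family.** At `T = 3P₀ =
(v²f²(f-1), v³f³(f-1)²)`: `T ≠ -T`, the tangent slope is `v(f² - 1)`, the level-`3`
normal-form coefficients are `A₁(T) = -v(f³ - 3f² + 1)`, `A₃(T) = -v³f³(f-1)³`, and the
level-`3` Hauptmodul `τ₃(T) - 27 = A₁(T)³/A₃(T) - 27` equals `η(η² + 9η + 27)` for the level-`9`
Hauptmodul `η = (f³ - 6f² + 3f + 1)/(f(f-1))` (indeed `τ₃(T) = (η + 3)³`; in Maier's notation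
`t₃ = t₉(t₉² + 9t₉ + 27)`). [cite: Maier2006, §5 (arXiv p. 20: t₉² + 9t₉ + 27 = t₃/t₉)] -/
theorem tau_three_sub_kubert (h4 : W.a₄ = 0) (ha₁ : W.a₁ = v * (1 - f ^ 2 * (f - 1)))
    (ha₂ : W.a₂ = -v ^ 2 * (f ^ 2 * (f - 1) * (f ^ 2 - f + 1)))
    (ha₃ : W.a₃ = -v ^ 3 * (f ^ 2 * (f - 1) * (f ^ 2 - f + 1))) (hv : v ≠ 0) (hf0 : f ≠ 0)
    (hf1 : f - 1 ≠ 0) :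
    v ^ 3 * (f ^ 3 * (f - 1) ^ 2) ≠
        W.toAffine.negY (v ^ 2 * (f ^ 2 * (f - 1))) (v ^ 3 * (f ^ 3 * (f - 1) ^ 2)) ∧
      W.toAffine.slope (v ^ 2 * (f ^ 2 * (f - 1))) (v ^ 2 * (f ^ 2 * (f - 1)))
          (v ^ 3 * (f ^ 3 * (f - 1) ^ 2)) (v ^ 3 * (f ^ 3 * (f - 1) ^ 2)) = v * (f ^ 2 - 1) ∧
      W.tgA₁ (v ^ 2 * (f ^ 2 * (f - 1))) (v ^ 3 * (f ^ 3 * (f - 1) ^ 2)) =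
          -(v * (f ^ 3 - 3 * f ^ 2 + 1)) ∧
      W.tgA₃ (v ^ 2 * (f ^ 2 * (f - 1))) (v ^ 3 * (f ^ 3 * (f - 1) ^ 2)) =
          -(v ^ 3 * (f ^ 3 * (f - 1) ^ 3)) ∧
      W.tgA₁ (v ^ 2 * (f ^ 2 * (f - 1))) (v ^ 3 * (f ^ 3 * (f - 1) ^ 2)) ^ 3 /
            W.tgA₃ (v ^ 2 * (f ^ 2 * (f - 1))) (v ^ 3 * (f ^ 3 * (f - 1) ^ 2)) - 27 =
        (f ^ 3 - 6 * f ^ 2 + 3 * f + 1) / (f * (f - 1)) *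
          (((f ^ 3 - 6 * f ^ 2 + 3 * f + 1) / (f * (f - 1))) ^ 2 +
            9 * ((f ^ 3 - 6 * f ^ 2 + 3 * f + 1) / (f * (f - 1))) + 27) := by
  have hnegY := kubert_negY_three_smul (W := W) ha₁ ha₃
  have hE : v ^ 3 * (f ^ 3 * (f - 1) ^ 2) - v ^ 3 * (f ^ 4 * (f - 1) ^ 2) =
      -(v ^ 3 * (f ^ 3 * (f - 1) ^ 3)) := by
    ring
  have hE0 : -(v ^ 3 * (f ^ 3 * (f - 1) ^ 3)) ≠ 0 :=
    neg_ne_zero.2 (mul_ne_zero (pow_ne_zero 3 hv) (mul_ne_zero (pow_ne_zero 3 hf0)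
      (pow_ne_zero 3 hf1)))
  have hy : v ^ 3 * (f ^ 3 * (f - 1) ^ 2) ≠
      W.toAffine.negY (v ^ 2 * (f ^ 2 * (f - 1))) (v ^ 3 * (f ^ 3 * (f - 1) ^ 2)) := by
    rw [hnegY]
    intro h
    exact hE0 (by rw [← hE, h, sub_self])
  have hL : W.toAffine.slope (v ^ 2 * (f ^ 2 * (f - 1))) (v ^ 2 * (f ^ 2 * (f - 1)))
      (v ^ 3 * (f ^ 3 * (f - 1) ^ 2)) (v ^ 3 * (f ^ 3 * (f - 1) ^ 2)) = v * (f ^ 2 - 1) := by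
    rw [Affine.slope_of_Y_ne rfl hy, hnegY, hE, div_eq_iff hE0]
    simp only [h4, add_zero]
    rw [ha₁, ha₂]
    ring
  have hA₁ : W.tgA₁ (v ^ 2 * (f ^ 2 * (f - 1))) (v ^ 3 * (f ^ 3 * (f - 1) ^ 2)) =
      -(v * (f ^ 3 - 3 * f ^ 2 + 1)) := by
    rw [tgA₁, hL, ha₁]
    ring
  have hA₃ : W.tgA₃ (v ^ 2 * (f ^ 2 * (f - 1))) (v ^ 3 * (f ^ 3 * (f - 1) ^ 2)) =
      -(v ^ 3 * (f ^ 3 * (f - 1) ^ 3)) := by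
    rw [tgA₃, hnegY, hE]
  refine ⟨hy, hL, hA₁, hA₃, ?_⟩
  rw [hA₁, hA₃]
  field_simp
  ring

/-- **Vélu's `3`-quotient by `⟨T⟩`, `T = 3P₀`, on Kubert's family** (characteristic `0`). With
`x_T = v²f²(f-1)`, `y_T = v³f³(f-1)²` and the coordinate change
`D = (1, x_T, -a₁/2, -(a₃ + a₁x_T)/2)` (moving `T` to `x = 0` and killing `a₁, a₃`):
`D • E = [0, v²(f³-3f²+1)²/4, 0, v⁴f³(f-1)³(f³-3f²+1)/2, v⁶f⁶(f-1)⁶/4]` (the model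
`y² = x³ + (mx + s)²` of `WeierstrassCurve.IsVeluThreePair` with `s = -v³f³(f-1)³/2`,
`m = -v(f³-3f²+1)/2`), `D(T) = (0, s)` and `D(P₀) = (-v²f²(f-1), -v³f²(f-1)(f²-f+1)/2)`.
[folklore] -/
theorem velu_model_kubert [CharZero F] (h4 : W.a₄ = 0) (h6 : W.a₆ = 0)
    (ha₁ : W.a₁ = v * (1 - f ^ 2 * (f - 1)))
    (ha₂ : W.a₂ = -v ^ 2 * (f ^ 2 * (f - 1) * (f ^ 2 - f + 1)))
    (ha₃ : W.a₃ = -v ^ 3 * (f ^ 2 * (f - 1) * (f ^ 2 - f + 1))) :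
    ((⟨1, v ^ 2 * (f ^ 2 * (f - 1)), -W.a₁ / 2, -(W.a₃ + W.a₁ * (v ^ 2 * (f ^ 2 * (f - 1)))) / 2⟩ :
          VariableChange F) • W).a₁ = 0 ∧
      ((⟨1, v ^ 2 * (f ^ 2 * (f - 1)), -W.a₁ / 2, -(W.a₃ + W.a₁ * (v ^ 2 * (f ^ 2 * (f - 1)))) / 2⟩ :
          VariableChange F) • W).a₂ = v ^ 2 * (f ^ 3 - 3 * f ^ 2 + 1) ^ 2 / 4 ∧
      ((⟨1, v ^ 2 * (f ^ 2 * (f - 1)), -W.a₁ / 2, -(W.a₃ + W.a₁ * (v ^ 2 * (f ^ 2 * (f - 1)))) / 2⟩ :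
          VariableChange F) • W).a₃ = 0 ∧
      ((⟨1, v ^ 2 * (f ^ 2 * (f - 1)), -W.a₁ / 2, -(W.a₃ + W.a₁ * (v ^ 2 * (f ^ 2 * (f - 1)))) / 2⟩ :
          VariableChange F) • W).a₄ = v ^ 4 * (f ^ 3 * (f - 1) ^ 3 * (f ^ 3 - 3 * f ^ 2 + 1)) / 2 ∧
      ((⟨1, v ^ 2 * (f ^ 2 * (f - 1)), -W.a₁ / 2, -(W.a₃ + W.a₁ * (v ^ 2 * (f ^ 2 * (f - 1)))) / 2⟩ :
          VariableChange F) • W).a₆ = v ^ 6 * (f ^ 6 * (f - 1) ^ 6) / 4 ∧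
      (⟨1, v ^ 2 * (f ^ 2 * (f - 1)), -W.a₁ / 2, -(W.a₃ + W.a₁ * (v ^ 2 * (f ^ 2 * (f - 1)))) / 2⟩ :
          VariableChange F).toX (v ^ 2 * (f ^ 2 * (f - 1))) = 0 ∧
      (⟨1, v ^ 2 * (f ^ 2 * (f - 1)), -W.a₁ / 2, -(W.a₃ + W.a₁ * (v ^ 2 * (f ^ 2 * (f - 1)))) / 2⟩ :
          VariableChange F).toY (v ^ 2 * (f ^ 2 * (f - 1))) (v ^ 3 * (f ^ 3 * (f - 1) ^ 2)) =
        -(v ^ 3 * (f ^ 3 * (f - 1) ^ 3)) / 2 ∧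
      (⟨1, v ^ 2 * (f ^ 2 * (f - 1)), -W.a₁ / 2, -(W.a₃ + W.a₁ * (v ^ 2 * (f ^ 2 * (f - 1)))) / 2⟩ :
          VariableChange F).toX 0 = -(v ^ 2 * (f ^ 2 * (f - 1))) ∧
      (⟨1, v ^ 2 * (f ^ 2 * (f - 1)), -W.a₁ / 2, -(W.a₃ + W.a₁ * (v ^ 2 * (f ^ 2 * (f - 1)))) / 2⟩ :
          VariableChange F).toY 0 0 = -(v ^ 3 * (f ^ 2 * (f - 1) * (f ^ 2 - f + 1))) / 2 := by
  simp only [variableChange_a₁, variableChange_a₂, variableChange_a₃, variableChange_a₄,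
    variableChange_a₆, VariableChange.toX_def, VariableChange.toY_def, inv_one, Units.val_one,
    one_pow, one_mul, h4, h6]
  rw [ha₁, ha₂, ha₃]
  exact ⟨by ring, by ring, by ring, by ring, by ring, by ring, by ring, by ring, by ring⟩

/-- **The level-`3` Hauptmodul of `(E/⟨T⟩, image of P₀)` on Kubert's family** (the degeneracy
map `X₀(9) → X₀(3)`, `(E, C₉) ↦ (E/3C₉, C₉/3C₉)`, in coordinates). On Vélu's quotient
`E' = [0, A₂, 0, -9A₄, -(27A₆ + 8A₂A₄)]` of `D • E = [0, A₂, 0, A₄, A₆]` (`velu_model_kubert`;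
`WeierstrassCurve.threeIsogenyCodomain`), the image
`Q̄ = ((z³ + 2A₄z + 4A₆)/z², w(z³ - 2A₄z - 8A₆)/z³)` of `D(P₀) = (z, w)` under Vélu's map
(`WeierstrassCurve.IsVeluThreePair.X/Y`) is `(fv²(f-1)(f³-3f+1), -fv³(f-1)(f²-f+1)³/2)`, a point
of order `3` with `A₁(Q̄) = -v(f³+3f²-6f+1)`, `A₃(Q̄) = -fv³(f-1)(f²-f+1)³`, and its level-`3`
Hauptmodul is `τ₃(Q̄) - 27 = (f³-6f²+3f+1)³/(f(f-1)(f²-f+1)³) = η³/(η² + 9η + 27)`,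
`η = (f³-6f²+3f+1)/(f(f-1))` (Maier: `t₃ = t₉³/(t₉² + 9t₉ + 27)` along the second degeneracy).
Verified symbolically (sympy). [folklore] -/
theorem tau_three_velu_kubert [CharZero F] (hv : v ≠ 0) (hf0 : f ≠ 0) (hf1 : f - 1 ≠ 0)
    (hq : f ^ 2 - f + 1 ≠ 0) {A₂ A₄ A₆ z w : F}
    (hA₂ : A₂ = v ^ 2 * (f ^ 3 - 3 * f ^ 2 + 1) ^ 2 / 4)
    (hA₄ : A₄ = v ^ 4 * (f ^ 3 * (f - 1) ^ 3 * (f ^ 3 - 3 * f ^ 2 + 1)) / 2)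
    (hA₆ : A₆ = v ^ 6 * (f ^ 6 * (f - 1) ^ 6) / 4) (hz : z = -(v ^ 2 * (f ^ 2 * (f - 1))))
    (hw : w = -(v ^ 3 * (f ^ 2 * (f - 1) * (f ^ 2 - f + 1))) / 2) {E : WeierstrassCurve F}
    (hE : E = ⟨0, A₂, 0, -9 * A₄, -(27 * A₆ + 8 * A₂ * A₄)⟩) :
    w * (z ^ 3 - 2 * A₄ * z - 8 * A₆) / z ^ 3 ≠
        E.toAffine.negY ((z ^ 3 + 2 * A₄ * z + 4 * A₆) / z ^ 2)
          (w * (z ^ 3 - 2 * A₄ * z - 8 * A₆) / z ^ 3) ∧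
      E.tgA₁ ((z ^ 3 + 2 * A₄ * z + 4 * A₆) / z ^ 2) (w * (z ^ 3 - 2 * A₄ * z - 8 * A₆) / z ^ 3) ^
            3 /
          E.tgA₃ ((z ^ 3 + 2 * A₄ * z + 4 * A₆) / z ^ 2)
            (w * (z ^ 3 - 2 * A₄ * z - 8 * A₆) / z ^ 3) - 27 =
        ((f ^ 3 - 6 * f ^ 2 + 3 * f + 1) / (f * (f - 1))) ^ 3 /
          (((f ^ 3 - 6 * f ^ 2 + 3 * f + 1) / (f * (f - 1))) ^ 2 +
            9 * ((f ^ 3 - 6 * f ^ 2 + 3 * f + 1) / (f * (f - 1))) + 27) := by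
  subst hA₂ hA₄ hA₆ hz hw
  -- the image point `Q̄ = (X₁, Y₁)`
  have hz : -(v ^ 2 * (f ^ 2 * (f - 1))) ≠ 0 :=
    neg_ne_zero.2 (mul_ne_zero (pow_ne_zero 2 hv) (mul_ne_zero (pow_ne_zero 2 hf0) hf1))
  have hX : ((-(v ^ 2 * (f ^ 2 * (f - 1)))) ^ 3 +
        2 * (v ^ 4 * (f ^ 3 * (f - 1) ^ 3 * (f ^ 3 - 3 * f ^ 2 + 1)) / 2) *
          -(v ^ 2 * (f ^ 2 * (f - 1))) + 4 * (v ^ 6 * (f ^ 6 * (f - 1) ^ 6) / 4)) /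
        (-(v ^ 2 * (f ^ 2 * (f - 1)))) ^ 2 = v ^ 2 * (f * (f - 1) * (f ^ 3 - 3 * f + 1)) := by
    rw [div_eq_iff (pow_ne_zero 2 hz)]
    ring
  have hY : -(v ^ 3 * (f ^ 2 * (f - 1) * (f ^ 2 - f + 1))) / 2 *
        ((-(v ^ 2 * (f ^ 2 * (f - 1)))) ^ 3 -
            2 * (v ^ 4 * (f ^ 3 * (f - 1) ^ 3 * (f ^ 3 - 3 * f ^ 2 + 1)) / 2) *
              -(v ^ 2 * (f ^ 2 * (f - 1))) - 8 * (v ^ 6 * (f ^ 6 * (f - 1) ^ 6) / 4)) /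
        (-(v ^ 2 * (f ^ 2 * (f - 1)))) ^ 3 = -(v ^ 3 * (f * (f - 1) * (f ^ 2 - f + 1) ^ 3)) / 2 := by
    rw [div_eq_iff (pow_ne_zero 3 hz)]
    ring
  rw [hX, hY]
  have hE₁ : E.a₁ = 0 := by rw [hE]
  have hE₂ : E.a₂ = v ^ 2 * (f ^ 3 - 3 * f ^ 2 + 1) ^ 2 / 4 := by rw [hE]
  have hE₃ : E.a₃ = 0 := by rw [hE]
  have hE₄ : E.a₄ = -9 * (v ^ 4 * (f ^ 3 * (f - 1) ^ 3 * (f ^ 3 - 3 * f ^ 2 + 1)) / 2) := by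
    rw [hE]
  have hnegY : E.toAffine.negY (v ^ 2 * (f * (f - 1) * (f ^ 3 - 3 * f + 1)))
      (-(v ^ 3 * (f * (f - 1) * (f ^ 2 - f + 1) ^ 3)) / 2) =
        v ^ 3 * (f * (f - 1) * (f ^ 2 - f + 1) ^ 3) / 2 := by
    simp only [Affine.negY, hE₁, hE₃]
    ring
  have hD : -(v ^ 3 * (f * (f - 1) * (f ^ 2 - f + 1) ^ 3)) / 2 -
      v ^ 3 * (f * (f - 1) * (f ^ 2 - f + 1) ^ 3) / 2 =
        -(v ^ 3 * (f * (f - 1) * (f ^ 2 - f + 1) ^ 3)) := by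
    ring
  have hD0 : -(v ^ 3 * (f * (f - 1) * (f ^ 2 - f + 1) ^ 3)) ≠ 0 :=
    neg_ne_zero.2 (mul_ne_zero (pow_ne_zero 3 hv) (mul_ne_zero (mul_ne_zero hf0 hf1)
      (pow_ne_zero 3 hq)))
  have hy : -(v ^ 3 * (f * (f - 1) * (f ^ 2 - f + 1) ^ 3)) / 2 ≠
      E.toAffine.negY (v ^ 2 * (f * (f - 1) * (f ^ 3 - 3 * f + 1)))
        (-(v ^ 3 * (f * (f - 1) * (f ^ 2 - f + 1) ^ 3)) / 2) := by
    rw [hnegY]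
    intro h
    exact hD0 (by rw [← hD, h, sub_self])
  have hL : E.toAffine.slope (v ^ 2 * (f * (f - 1) * (f ^ 3 - 3 * f + 1)))
      (v ^ 2 * (f * (f - 1) * (f ^ 3 - 3 * f + 1)))
      (-(v ^ 3 * (f * (f - 1) * (f ^ 2 - f + 1) ^ 3)) / 2)
      (-(v ^ 3 * (f * (f - 1) * (f ^ 2 - f + 1) ^ 3)) / 2) =
        -(v * (f ^ 3 + 3 * f ^ 2 - 6 * f + 1)) / 2 := by
    rw [Affine.slope_of_Y_ne rfl hy, hnegY, hD, div_eq_iff hD0, hE₁, hE₂, hE₄]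
    ring
  have hA₁ : E.tgA₁ (v ^ 2 * (f * (f - 1) * (f ^ 3 - 3 * f + 1)))
      (-(v ^ 3 * (f * (f - 1) * (f ^ 2 - f + 1) ^ 3)) / 2) =
        -(v * (f ^ 3 + 3 * f ^ 2 - 6 * f + 1)) := by
    rw [tgA₁, hL, hE₁]
    ring
  have hA₃ : E.tgA₃ (v ^ 2 * (f * (f - 1) * (f ^ 3 - 3 * f + 1)))
      (-(v ^ 3 * (f * (f - 1) * (f ^ 2 - f + 1) ^ 3)) / 2) =
        -(v ^ 3 * (f * (f - 1) * (f ^ 2 - f + 1) ^ 3)) := by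
    rw [tgA₃, hnegY, hD]
  refine ⟨hy, ?_⟩
  have hS : ((f ^ 3 - 6 * f ^ 2 + 3 * f + 1) / (f * (f - 1))) ^ 2 +
      9 * ((f ^ 3 - 6 * f ^ 2 + 3 * f + 1) / (f * (f - 1))) + 27 =
        (f ^ 2 - f + 1) ^ 3 / (f ^ 2 * (f - 1) ^ 2) := by
    field_simp
    ring
  have hB : f * (f - 1) * (f ^ 2 - f + 1) ^ 3 ≠ 0 :=
    mul_ne_zero (mul_ne_zero hf0 hf1) (pow_ne_zero 3 hq)
  have hl : (-(v * (f ^ 3 + 3 * f ^ 2 - 6 * f + 1))) ^ 3 /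
      -(v ^ 3 * (f * (f - 1) * (f ^ 2 - f + 1) ^ 3)) =
        (f ^ 3 + 3 * f ^ 2 - 6 * f + 1) ^ 3 / (f * (f - 1) * (f ^ 2 - f + 1) ^ 3) := by
    rw [div_eq_div_iff hD0 hB]
    ring
  have hr : ((f ^ 3 - 6 * f ^ 2 + 3 * f + 1) / (f * (f - 1))) ^ 3 /
      ((f ^ 2 - f + 1) ^ 3 / (f ^ 2 * (f - 1) ^ 2)) =
        (f ^ 3 - 6 * f ^ 2 + 3 * f + 1) ^ 3 / (f * (f - 1) * (f ^ 2 - f + 1) ^ 3) := by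
    rw [div_pow, div_div_eq_mul_div, div_mul_eq_mul_div, div_div,
      div_eq_div_iff (mul_ne_zero (pow_ne_zero 3 (mul_ne_zero hf0 hf1)) (pow_ne_zero 3 hq)) hB]
    ring
  rw [hA₁, hA₃, hS, hl, hr, eq_div_iff hB, sub_mul, div_mul_cancel₀ _ hB]
  ring

end Family

/-! ### §2. Point level: an order-`9` point `P`, `T = 3P`, and Vélu's quotient by `⟨T⟩` -/

section PointLevel

variable {V : WeierstrassCurve F}

/-- **Level `9` versus level `3` at a point of order `9`** (characteristic `0`). Let `P = (x₀, y₀)`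
have order `9` on `V` (`9P = O`, `3P ≠ O`), `T = 3P = (x₃, y₃)`, `f = f(P)` Kubert's coordinate
(`WeierstrassCurve.tateNine`) and `η = (f³ - 6f² + 3f + 1)/(f(f - 1))` the level-`9` Hauptmodul.
Let `D = (1, x₃, -a₁/2, -(a₃ + a₁x₃)/2)`, `W₁ = D • V` and `E = [0, a₂(W₁), 0, -9a₄(W₁),
-(27a₆(W₁) + 8a₂(W₁)a₄(W₁))]` (Vélu's quotient `W₁/⟨T⟩`). Then:
(T) `T ≠ -T` and the level-`3` Hauptmodul of `(V, ⟨T⟩)` is `τ₃(T) - 27 = A₁(T)³/A₃(T) - 27 =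
η(η² + 9η + 27)`;
(W₁) `W₁ = [0, m², 0, 2ms, s²]` with `D(T) = (0, s)`, `s ≠ 0`, `m = a₄(W₁)/(2s)`
(the shape of `WeierstrassCurve.IsVeluThreePair`);
(P) `D(P) = (z, w)` has `z ≠ 0`, and its Vélu image `Q̄ = ((z³ + 2a₄z + 4a₆)/z²,
w(z³ - 2a₄z - 8a₆)/z³)` on `E` satisfies `Q̄ ≠ -Q̄` and `τ₃(Q̄) - 27 = η³/(η² + 9η + 27)`.
Proof: normalise at `P` (`(1, x₀, λ_P, y₀)`, Kubert's family, `D = D_𝒦 ∘ C_P`) and use §1.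
[cite: Maier2006, §5 (the level-9/level-3 relations t₃ = t₉(t₉²+9t₉+27), t₃' = t₉³/(t₉²+9t₉+27))] -/
theorem level_nine_three_smul [CharZero F] {x₀ y₀ : F} {h : V.toAffine.Nonsingular x₀ y₀}
    (h9 : (9 : ℕ) • (Affine.Point.some _ _ h : V.toAffine.Point) = 0)
    (h3 : (3 : ℕ) • (Affine.Point.some _ _ h : V.toAffine.Point) ≠ 0)
    {x₃ y₃ : F} {h₃ : V.toAffine.Nonsingular x₃ y₃}
    (hT : (Affine.Point.some _ _ h : V.toAffine.Point) + (.some _ _ h + .some _ _ h) =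
      .some _ _ h₃)
    {D : VariableChange F} (hD : D = ⟨1, x₃, -V.a₁ / 2, -(V.a₃ + V.a₁ * x₃) / 2⟩)
    {W₁ : WeierstrassCurve F} (hW₁ : D • V = W₁) {E : WeierstrassCurve F}
    (hE : E = ⟨0, W₁.a₂, 0, -9 * W₁.a₄, -(27 * W₁.a₆ + 8 * W₁.a₂ * W₁.a₄)⟩) :
    (y₃ ≠ V.toAffine.negY x₃ y₃ ∧
      V.tgA₁ x₃ y₃ ^ 3 / V.tgA₃ x₃ y₃ - 27 =
        (V.tateNine x₀ y₀ ^ 3 - 6 * V.tateNine x₀ y₀ ^ 2 + 3 * V.tateNine x₀ y₀ + 1) /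
            (V.tateNine x₀ y₀ * (V.tateNine x₀ y₀ - 1)) *
          (((V.tateNine x₀ y₀ ^ 3 - 6 * V.tateNine x₀ y₀ ^ 2 + 3 * V.tateNine x₀ y₀ + 1) /
                (V.tateNine x₀ y₀ * (V.tateNine x₀ y₀ - 1))) ^ 2 +
            9 * ((V.tateNine x₀ y₀ ^ 3 - 6 * V.tateNine x₀ y₀ ^ 2 + 3 * V.tateNine x₀ y₀ + 1) /
                (V.tateNine x₀ y₀ * (V.tateNine x₀ y₀ - 1))) + 27)) ∧
    (W₁.a₁ = 0 ∧ W₁.a₃ = 0 ∧ D.toX x₃ = 0 ∧ D.toY x₃ y₃ ≠ 0 ∧ W₁.a₆ = D.toY x₃ y₃ ^ 2 ∧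
      W₁.a₂ = (W₁.a₄ / (2 * D.toY x₃ y₃)) ^ 2) ∧
    (D.toX x₀ ≠ 0 ∧
      D.toY x₀ y₀ * (D.toX x₀ ^ 3 - 2 * W₁.a₄ * D.toX x₀ - 8 * W₁.a₆) / D.toX x₀ ^ 3 ≠
        E.toAffine.negY ((D.toX x₀ ^ 3 + 2 * W₁.a₄ * D.toX x₀ + 4 * W₁.a₆) / D.toX x₀ ^ 2)
          (D.toY x₀ y₀ * (D.toX x₀ ^ 3 - 2 * W₁.a₄ * D.toX x₀ - 8 * W₁.a₆) / D.toX x₀ ^ 3) ∧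
      E.tgA₁ ((D.toX x₀ ^ 3 + 2 * W₁.a₄ * D.toX x₀ + 4 * W₁.a₆) / D.toX x₀ ^ 2)
            (D.toY x₀ y₀ * (D.toX x₀ ^ 3 - 2 * W₁.a₄ * D.toX x₀ - 8 * W₁.a₆) / D.toX x₀ ^ 3) ^
            3 /
          E.tgA₃ ((D.toX x₀ ^ 3 + 2 * W₁.a₄ * D.toX x₀ + 4 * W₁.a₆) / D.toX x₀ ^ 2)
            (D.toY x₀ y₀ * (D.toX x₀ ^ 3 - 2 * W₁.a₄ * D.toX x₀ - 8 * W₁.a₆) / D.toX x₀ ^ 3) -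
          27 =
        ((V.tateNine x₀ y₀ ^ 3 - 6 * V.tateNine x₀ y₀ ^ 2 + 3 * V.tateNine x₀ y₀ + 1) /
              (V.tateNine x₀ y₀ * (V.tateNine x₀ y₀ - 1))) ^ 3 /
          (((V.tateNine x₀ y₀ ^ 3 - 6 * V.tateNine x₀ y₀ ^ 2 + 3 * V.tateNine x₀ y₀ + 1) /
                (V.tateNine x₀ y₀ * (V.tateNine x₀ y₀ - 1))) ^ 2 +
            9 * ((V.tateNine x₀ y₀ ^ 3 - 6 * V.tateNine x₀ y₀ ^ 2 + 3 * V.tateNine x₀ y₀ + 1) /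
                (V.tateNine x₀ y₀ * (V.tateNine x₀ y₀ - 1))) + 27)) := by
  set P : V.toAffine.Point := .some _ _ h with hPdef
  -- consequences of `9P = O`, `3P ≠ O` in the group
  have hy : y₀ ≠ V.toAffine.negY x₀ y₀ := by
    intro hyy
    have h2 : P + P = 0 := Affine.Point.add_self_of_Y_eq hyy
    apply Affine.Point.some_ne_zero h
    have e : P = (9 : ℕ) • P - (P + P) - (P + P) - (P + P) - (P + P) := by abel
    rw [← hPdef, e, h2, h9]
    simp only [sub_zero]
  have hT9 : (P + (P + P)) + (P + (P + P)) = -(P + (P + P)) := by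
    apply eq_neg_of_add_eq_zero_left
    have e : (P + (P + P)) + (P + (P + P)) + (P + (P + P)) = (9 : ℕ) • P := by abel
    rw [e, h9]
  have hT6 : (P + (P + P)) + (P + (P + P)) ≠ 0 := by
    intro h6
    apply h3
    have e : (3 : ℕ) • P = (P + (P + P)) + (P + (P + P)) + (P + (P + P)) -
        ((P + (P + P)) + (P + (P + P))) := by abel
    have e' : (P + (P + P)) + (P + (P + P)) + (P + (P + P)) = (9 : ℕ) • P := by abel
    rw [e, e', h9, h6, sub_zero]
  have hne : P + P ≠ -P := by
    intro h2
    apply h3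
    have e : (3 : ℕ) • P = P + (P + P) := by abel
    rw [e, h2, add_neg_cancel]
  have hy₃ : y₃ ≠ V.toAffine.negY x₃ y₃ := fun hyy =>
    hT6 (by rw [hT]; exact Affine.Point.add_self_of_Y_eq hyy)
  simp only [hPdef] at hne hT6 hT9 hT
  -- normalise at `P`
  have hV' := variableChange_tangent_eq (W := V) h.1 hy
  obtain ⟨h₀, hP'⟩ := pointEquiv_tangent_some (W := V) h
  have hT' := VariableChange.pointEquiv_some V
    (⟨1, x₀, V.toAffine.slope x₀ x₀ y₀ y₀, y₀⟩ : VariableChange F) h₃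
  have hf₀ := tateNine_toXY (W := V) (⟨1, x₀, V.toAffine.slope x₀ x₀ y₀ y₀, y₀⟩ :
    VariableChange F) rfl h.1 hy
  have hA₁T := tgA₁_toXY (W := V) (⟨1, x₀, V.toAffine.slope x₀ x₀ y₀ y₀, y₀⟩ :
    VariableChange F) rfl h₃.1 hy₃
  have hA₃T := tgA₃_toXY (W := V) (⟨1, x₀, V.toAffine.slope x₀ x₀ y₀ y₀, y₀⟩ :
    VariableChange F) rfl x₃ y₃
  revert h₀ hP' hV' hT' hf₀ hA₁T hA₃T
  generalize hC : (⟨1, x₀, V.toAffine.slope x₀ x₀ y₀ y₀, y₀⟩ : VariableChange F) = C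
  intro hV' h₀ hP' hT' hf₀ hA₁T hA₃T
  have hCu : C.u = 1 := by rw [← hC]
  have hCr : C.r = x₀ := by rw [← hC]
  have hCt : C.t = y₀ := by rw [← hC]
  have h4' : (C • V).a₄ = 0 := by rw [hV']
  have h6' : (C • V).a₆ = 0 := by rw [hV']
  have h3' : (C • V).a₃ ≠ 0 := by rw [hV']; exact sub_ne_zero.2 hy
  have hVa₁ : (C • V).a₁ = V.a₁ + 2 * C.s := by
    rw [variableChange_a₁, hCu]
    simp only [inv_one, Units.val_one, one_mul]
  have hVa₃ : (C • V).a₃ = V.a₃ + x₀ * V.a₁ + 2 * y₀ := by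
    rw [variableChange_a₃, hCu, hCr, hCt]
    simp only [inv_one, Units.val_one, one_pow, one_mul]
  -- transport the group-law facts to the normal form `𝒦 = C • V`, `P ↦ (0,0)`
  have hne' : VariableChange.pointEquiv V C (.some _ _ h + .some _ _ h) ≠
      VariableChange.pointEquiv V C (-.some _ _ h) :=
    fun e => hne ((VariableChange.pointEquiv V C).injective e)
  have hT6' : VariableChange.pointEquiv V C
      ((.some _ _ h + (.some _ _ h + .some _ _ h)) + (.some _ _ h + (.some _ _ h + .some _ _ h))) ≠
        0 :=
    fun e => hT6 ((VariableChange.pointEquiv V C).injective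
      (e.trans (map_zero (VariableChange.pointEquiv V C)).symm))
  have hT9' := congrArg (VariableChange.pointEquiv V C) hT9
  simp only [map_add, map_neg, hP'] at hne' hT6' hT9'
  obtain ⟨h2', hR'⟩ := tate_relation_of_order_nine h4' h6' h3' hne' hT6' hT9'
  obtain ⟨-, -, hf0, hf1, hq, ha₁, ha₂, ha₃⟩ := tate_parametrisation_nine h2' h3' hR'
  obtain ⟨v, hv⟩ : ∃ v, v = (C • V).a₃ / (C • V).a₂ := ⟨_, rfl⟩
  obtain ⟨f, hf⟩ : ∃ f, f = -((C • V).a₃ - (C • V).a₁ * (C • V).a₂) ^ 2 /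
      ((C • V).a₂ ^ 3 - (C • V).a₁ * (C • V).a₂ * (C • V).a₃ + (C • V).a₃ ^ 2) := ⟨_, rfl⟩
  rw [← hv, ← hf] at ha₁ ha₂ ha₃
  rw [← hf] at hf0 hf1 hq
  have hv0 : v ≠ 0 := by rw [hv]; exact div_ne_zero h3' h2'
  -- `f(P) = f`
  have hP'' := hP'
  rw [VariableChange.pointEquiv_some] at hP''
  obtain ⟨hX0, hY0⟩ := (Affine.Point.some.injEq _ _ _ _ _ _).mp hP''
  have hfP : V.tateNine x₀ y₀ = f := by rw [← hf₀, hX0, hY0, tateNine_origin h4' h3', hf]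
  -- `T ↦ 3·(0,0) = (v²f²(f-1), v³f³(f-1)²)`
  obtain ⟨hxT, hyT⟩ := kubert_three_smul_coord ha₁ ha₂ ha₃ hv0 hf0 hf1 hq
  obtain ⟨hT₀, h3P₀⟩ := three_smul_zero_zero h4' h6' h3' h2'
  have h3T := congrArg (VariableChange.pointEquiv V C) hT
  rw [map_add, map_add, hP', hT', h3P₀] at h3T
  obtain ⟨hX3, hY3⟩ := (Affine.Point.some.injEq _ _ _ _ _ _).mp h3T
  have hx₃ : C.toX x₃ = v ^ 2 * (f ^ 2 * (f - 1)) := hX3.symm.trans hxT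
  have hy₃v : C.toY x₃ y₃ = v ^ 3 * (f ^ 3 * (f - 1) ^ 2) := hY3.symm.trans hyT
  -- `x₃ = x₀ + v²f²(f-1)` and `D = D_𝒦 ∘ C`, `D_𝒦 = (1, x_T, -a₁'/2, -(a₃' + a₁'x_T)/2)`
  have hx₃' : x₃ = x₀ + v ^ 2 * (f ^ 2 * (f - 1)) := by
    have e := hx₃
    rw [VariableChange.toX_def, hCu, hCr] at e
    simp only [inv_one, Units.val_one, one_pow, one_mul] at e
    linear_combination e
  have hDK : D = (⟨1, v ^ 2 * (f ^ 2 * (f - 1)), -(C • V).a₁ / 2,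
      -((C • V).a₃ + (C • V).a₁ * (v ^ 2 * (f ^ 2 * (f - 1)))) / 2⟩ : VariableChange F) * C := by
    rw [hD, VariableChange.mul_def, hCu, hCr, hCt, hVa₁, hVa₃, hx₃']
    simp only [Units.val_one, one_pow, mul_one, one_mul]
    congr 1 <;> ring
  have hW₁K : W₁ = (⟨1, v ^ 2 * (f ^ 2 * (f - 1)), -(C • V).a₁ / 2,
      -((C • V).a₃ + (C • V).a₁ * (v ^ 2 * (f ^ 2 * (f - 1)))) / 2⟩ : VariableChange F) •
        (C • V) := by
    rw [← hW₁, hDK, mul_smul]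
  obtain ⟨hK₁, hK₂, hK₃, hK₄, hK₆, hKx, hKy, hKx0, hKy0⟩ :=
    velu_model_kubert (W := C • V) h4' h6' ha₁ ha₂ ha₃
  have hDx₃ : D.toX x₃ = 0 := by rw [hDK, VariableChange.toX_mul, hx₃, hKx]
  have hDy₃ : D.toY x₃ y₃ = -(v ^ 3 * (f ^ 3 * (f - 1) ^ 3)) / 2 := by
    rw [hDK, VariableChange.toY_mul, hx₃, hy₃v, hKy]
  have hDx₀ : D.toX x₀ = -(v ^ 2 * (f ^ 2 * (f - 1))) := by
    rw [hDK, VariableChange.toX_mul, hX0, hKx0]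
  have hDy₀ : D.toY x₀ y₀ = -(v ^ 3 * (f ^ 2 * (f - 1) * (f ^ 2 - f + 1))) / 2 := by
    rw [hDK, VariableChange.toY_mul, hX0, hY0, hKy0]
  have hA₂ : W₁.a₂ = v ^ 2 * (f ^ 3 - 3 * f ^ 2 + 1) ^ 2 / 4 := by rw [hW₁K, hK₂]
  have hA₄ : W₁.a₄ = v ^ 4 * (f ^ 3 * (f - 1) ^ 3 * (f ^ 3 - 3 * f ^ 2 + 1)) / 2 := by
    rw [hW₁K, hK₄]
  have hA₆ : W₁.a₆ = v ^ 6 * (f ^ 6 * (f - 1) ^ 6) / 4 := by rw [hW₁K, hK₆]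
  have hs0 : -(v ^ 3 * (f ^ 3 * (f - 1) ^ 3)) / 2 ≠ 0 :=
    div_ne_zero (neg_ne_zero.2 (mul_ne_zero (pow_ne_zero 3 hv0)
      (mul_ne_zero (pow_ne_zero 3 hf0) (pow_ne_zero 3 hf1)))) two_ne_zero
  rw [hfP]
  refine ⟨?_, ?_, ?_⟩
  · -- (T)
    obtain ⟨-, -, -, -, hτ⟩ := tau_three_sub_kubert h4' ha₁ ha₂ ha₃ hv0 hf0 hf1
    rw [hx₃, hy₃v] at hA₁T hA₃T
    rw [← hA₁T, ← hA₃T]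
    exact ⟨hy₃, hτ⟩
  · -- (W₁)
    refine ⟨by rw [hW₁K, hK₁], by rw [hW₁K, hK₃], hDx₃, by rwa [hDy₃], ?_, ?_⟩
    · rw [hA₆, hDy₃]
      ring
    · have hm : W₁.a₄ / (2 * D.toY x₃ y₃) = -(v * (f ^ 3 - 3 * f ^ 2 + 1)) / 2 := by
        rw [hA₄, hDy₃, div_eq_iff (mul_ne_zero two_ne_zero hs0)]
        ring
      rw [hm, hA₂]
      ring
  · -- (P)
    have hvk := tau_three_velu_kubert hv0 hf0 hf1 hq hA₂ hA₄ hA₆ hDx₀ hDy₀ hE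
    refine ⟨?_, hvk.1, hvk.2⟩
    rw [hDx₀]
    exact neg_ne_zero.2 (mul_ne_zero (pow_ne_zero 2 hv0) (mul_ne_zero (pow_ne_zero 2 hf0) hf1))

end PointLevel

/-! ### §3. Klein–Fricke at level `9` with the value of the Hauptmodul (Galois descent) -/

section Descent

variable {L : Type u} [Field L] [Algebra F L]

/-- **Klein–Fricke, level `9`, with the value of the Hauptmodul.** Let `W/F` be an elliptic curve,
`L/F` Galois, and `P = (x₀, y₀) ∈ W(L)` a point of order `9` whose cyclic subgroup `ℤP` is
`Gal(L/F)`-stable. Then the level-`9` Hauptmodul `η = (f³ - 6f² + 3f + 1)/(f(f - 1))`,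
`f = f(P)` Kubert's coordinate (`WeierstrassCurve.tateNine`), lies in `F` (it only depends on
`ℤP`), `η(η² + 9η + 27) ≠ 0` and `j(W) · η(η² + 9η + 27) = (η + 3)³(η³ + 9η² + 27η + 3)³`.
This refines `WeierstrassCurve.exists_hauptmodul_nine_of_torsion` (same proof) by recording
`algebraMap F L η = η(f(P))`, which makes `η` functorial in `(W, ℤP)`.
[cite: Maier2006, Table 4 (N = 9)] -/
theorem exists_hauptmodul_nine_eq_of_torsion [IsGalois F L] [W.IsElliptic] {x₀ y₀ : L}
    {h : (W.baseChange L).toAffine.Nonsingular x₀ y₀}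
    (h9 : addOrderOf (Affine.Point.some _ _ h : (W.baseChange L).toAffine.Point) = 9)
    (hσ : ∀ σ : L ≃ₐ[F] L, σ • (Affine.Point.some _ _ h : (W.baseChange L).toAffine.Point) ∈
      AddSubgroup.zmultiples (Affine.Point.some _ _ h : (W.baseChange L).toAffine.Point)) :
    ∃ η : F, algebraMap F L η =
        ((W.baseChange L).tateNine x₀ y₀ ^ 3 - 6 * (W.baseChange L).tateNine x₀ y₀ ^ 2 +
            3 * (W.baseChange L).tateNine x₀ y₀ + 1) /
          ((W.baseChange L).tateNine x₀ y₀ * ((W.baseChange L).tateNine x₀ y₀ - 1)) ∧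
      η * (η ^ 2 + 9 * η + 27) ≠ 0 ∧
      W.j * (η * (η ^ 2 + 9 * η + 27)) = (η + 3) ^ 3 * (η ^ 3 + 9 * η ^ 2 + 27 * η + 3) ^ 3 := by
  obtain ⟨P, hP⟩ : ∃ P : (W.baseChange L).toAffine.Point, P = Affine.Point.some _ _ h := ⟨_, rfl⟩
  rw [← hP] at h9 hσ
  haveI : (W.baseChange L).IsElliptic := by rw [baseChange]; infer_instance
  -- order bookkeeping
  have h9P : (9 : ℕ) • P = 0 := h9 ▸ addOrderOf_nsmul_eq_zero P
  have hmul : ∀ k : ℕ, k • P = 0 → 9 ∣ k := fun k hk => h9 ▸ addOrderOf_dvd_of_nsmul_eq_zero hk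
  have hP0 : P ≠ 0 := fun e => by have := hmul 1 (by rw [one_nsmul, e]); omega
  have h2P : (2 : ℕ) • P ≠ 0 := fun e => by have := hmul 2 e; omega
  have h3P : (3 : ℕ) • P ≠ 0 := fun e => by have := hmul 3 e; omega
  have h4P : (4 : ℕ) • P ≠ 0 := fun e => by have := hmul 4 e; omega
  have h8P : (8 : ℕ) • P ≠ 0 := fun e => by have := hmul 8 e; omega
  subst hP
  -- `2P = (x₁, y₁)` and `4P = (x₂, y₂)` are affine
  obtain ⟨x₁, y₁, h₁, hQ⟩ : ∃ x₁ y₁ h₁, (Affine.Point.some _ _ h : (W.baseChange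
      L).toAffine.Point) + .some _ _ h = .some x₁ y₁ h₁ := by
    rcases hPP : (Affine.Point.some _ _ h : (W.baseChange L).toAffine.Point) + .some _ _ h with
        _ | ⟨x₁, y₁, h₁⟩
    · exact absurd (by rw [two_nsmul, hPP, ← Affine.Point.zero_def]) h2P
    · exact ⟨x₁, y₁, h₁, hPP⟩
  have e4 : (4 : ℕ) • (Affine.Point.some _ _ h : (W.baseChange L).toAffine.Point) =
      (.some _ _ h + .some _ _ h) + (.some _ _ h + .some _ _ h) := by
    abel
  obtain ⟨x₂, y₂, h₂, hR⟩ : ∃ x₂ y₂ h₂, (Affine.Point.some _ _ h₁ : (W.baseChange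
      L).toAffine.Point) + .some _ _ h₁ = .some x₂ y₂ h₂ := by
    rcases hQQ : (Affine.Point.some _ _ h₁ : (W.baseChange L).toAffine.Point) + .some _ _ h₁ with
        _ | ⟨x₂, y₂, h₂⟩
    · exact absurd (by rw [e4, hQ, hQQ, ← Affine.Point.zero_def]) h4P
    · exact ⟨x₂, y₂, h₂, hQQ⟩
  -- `P ≠ -P`, `2P ≠ -2P`, `4P ≠ -4P`
  have hy : y₀ ≠ (W.baseChange L).toAffine.negY x₀ y₀ := fun hyy =>
    h2P (by rw [two_nsmul]; exact Affine.Point.add_self_of_Y_eq hyy)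
  have hy₁ : y₁ ≠ (W.baseChange L).toAffine.negY x₁ y₁ := fun hyy =>
    h4P (by rw [e4, hQ]; exact Affine.Point.add_self_of_Y_eq hyy)
  have e8 : (8 : ℕ) • (Affine.Point.some _ _ h : (W.baseChange L).toAffine.Point) =
      ((.some _ _ h + .some _ _ h) + (.some _ _ h + .some _ _ h)) +
        ((.some _ _ h + .some _ _ h) + (.some _ _ h + .some _ _ h)) := by
    abel
  have hy₂ : y₂ ≠ (W.baseChange L).toAffine.negY x₂ y₂ := fun hyy =>
    h8P (by rw [e8, hQ, hR]; exact Affine.Point.add_self_of_Y_eq hyy)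
  -- Kubert's coordinate at `P` (`f₀`), `2P` (`f₁ = (f₀-1)/f₀`) and `4P` (`f₂ = (f₁-1)/f₁`)
  have h9Q : (9 : ℕ) • (Affine.Point.some _ _ h₁ : (W.baseChange L).toAffine.Point) = 0 := by
    rw [← hQ, nsmul_add, h9P, add_zero]
  have h3Q : (3 : ℕ) • (Affine.Point.some _ _ h₁ : (W.baseChange L).toAffine.Point) ≠ 0 := by
    rw [← hQ]
    intro e
    have e' : (6 : ℕ) • (Affine.Point.some _ _ h : (W.baseChange L).toAffine.Point) = 0 := by
      rw [← e]
      abel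
    have := hmul 6 e'
    omega
  obtain ⟨hf0, hf1, hq, hfQ, hD, hj⟩ :=
    tateNine_of_order_nine (V := W.baseChange L) h9P h3P hQ
  obtain ⟨hf0', hf1', -, hfR, -, -⟩ :=
    tateNine_of_order_nine (V := W.baseChange L) h9Q h3Q hR
  -- Galois moves `f(P)` within `{f₀, f₁, f₂}`
  have hT : ∀ σ : L ≃ₐ[F] L,
      σ ((W.baseChange L).tateNine x₀ y₀) = (W.baseChange L).tateNine x₀ y₀ ∨
      σ ((W.baseChange L).tateNine x₀ y₀) = (W.baseChange L).tateNine x₁ y₁ ∨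
      σ ((W.baseChange L).tateNine x₀ y₀) = (W.baseChange L).tateNine x₂ y₂ := by
    intro σ
    have key := map_tateNine (W := W) (σ : L →ₐ[F] L) x₀ y₀
    rw [AlgEquiv.coe_toAlgHom] at key
    rw [key]
    -- `σP = mP`, `m = n mod 9 ∈ {0, …, 8}`
    obtain ⟨n, hn⟩ := AddSubgroup.mem_zmultiples_iff.mp (hσ σ)
    have hmod := mod_addOrderOf_zsmul
      (Affine.Point.some _ _ h : (W.baseChange L).toAffine.Point) n
    rw [h9, hn] at hmod
    push_cast at hmod
    have h0n : 0 ≤ n % 9 := Int.emod_nonneg _ (by norm_num)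
    have h9n : n % 9 < 9 := Int.emod_lt_of_pos _ (by norm_num)
    -- coordinates of `σP` from an equation `σP = (x', y')`
    have coords : ∀ {x' y' : L} {h' : (W.baseChange L).toAffine.Nonsingular x' y'},
        σ • (Affine.Point.some _ _ h : (W.baseChange L).toAffine.Point) = .some _ _ h' →
          σ x₀ = x' ∧ σ y₀ = y' := by
      intro x' y' h' hσP
      change Affine.Point.map (σ : L →ₐ[F] L) (Affine.Point.some _ _ h) = _ at hσP
      rw [Affine.Point.map_some] at hσP
      simpa only [Affine.Point.some.injEq, AlgEquiv.coe_toAlgHom] using hσP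
    have e1 := map_nsmul (DistribSMul.toAddMonoidHom _ σ) 3
      (Affine.Point.some _ _ h : (W.baseChange L).toAffine.Point)
    simp only [DistribSMul.toAddMonoidHom_apply] at e1
    generalize n % 9 = m at hmod h0n h9n
    interval_cases m
    · -- `σP = O`: impossible
      rw [zero_zsmul] at hmod
      exact absurd ((smul_eq_zero_iff_eq σ).mp hmod.symm) (Affine.Point.some_ne_zero h)
    · -- `σP = P`
      rw [one_zsmul] at hmod
      obtain ⟨hx, hy'⟩ := coords hmod.symm
      exact Or.inl (by rw [hx, hy'])
    · -- `σP = 2P`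
      rw [two_zsmul, hQ] at hmod
      obtain ⟨hx, hy'⟩ := coords hmod.symm
      exact Or.inr (Or.inl (by rw [hx, hy']))
    · -- `σP = 3P`: then `σ(3P) = 9P = O`, impossible
      rw [ofNat_zsmul] at hmod
      refine (h3P ((smul_eq_zero_iff_eq σ).mp ?_)).elim
      rw [e1, ← hmod, smul_smul]
      exact h9P
    · -- `σP = 4P`
      rw [ofNat_zsmul, e4, hQ, hR] at hmod
      obtain ⟨hx, hy'⟩ := coords hmod.symm
      exact Or.inr (Or.inr (by rw [hx, hy']))
    · -- `σP = 5P = -4P`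
      have e5 : (5 : ℕ) • (Affine.Point.some _ _ h : (W.baseChange L).toAffine.Point) =
          -.some _ _ h₂ := by
        rw [eq_neg_iff_add_eq_zero, ← hR, ← hQ, ← e4, ← add_nsmul]
        exact h9P
      rw [ofNat_zsmul, e5, Affine.Point.neg_some] at hmod
      obtain ⟨hx, hy'⟩ := coords hmod.symm
      exact Or.inr (Or.inr (by rw [hx, hy', tateNine_negY hy₂]))
    · -- `σP = 6P`: then `σ(3P) = 18P = O`, impossible
      rw [ofNat_zsmul] at hmod
      refine (h3P ((smul_eq_zero_iff_eq σ).mp ?_)).elim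
      rw [e1, ← hmod, smul_smul, show (3 * 6 : ℕ) = 9 + 9 from rfl, add_nsmul, h9P, add_zero]
    · -- `σP = 7P = -2P`
      have e7 : (7 : ℕ) • (Affine.Point.some _ _ h : (W.baseChange L).toAffine.Point) =
          -.some _ _ h₁ := by
        rw [eq_neg_iff_add_eq_zero, ← hQ, ← two_nsmul, ← add_nsmul]
        exact h9P
      rw [ofNat_zsmul, e7, Affine.Point.neg_some] at hmod
      obtain ⟨hx, hy'⟩ := coords hmod.symm
      exact Or.inr (Or.inl (by rw [hx, hy', tateNine_negY hy₁]))
    · -- `σP = 8P = -P`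
      have e8' : (8 : ℕ) • (Affine.Point.some _ _ h : (W.baseChange L).toAffine.Point) =
          -.some _ _ h := by
        rw [eq_neg_iff_add_eq_zero, ← succ_nsmul]
        exact h9P
      rw [ofNat_zsmul, e8', Affine.Point.neg_some] at hmod
      obtain ⟨hx, hy'⟩ := coords hmod.symm
      exact Or.inl (by rw [hx, hy', tateNine_negY hy])
  -- hence `η = (f³ - 6f² + 3f + 1)/(f(f-1))` is Galois invariant
  revert hf0 hf1 hq hfQ hD hj hf0' hf1' hfR hT
  generalize (W.baseChange L).tateNine x₀ y₀ = u
  generalize (W.baseChange L).tateNine x₁ y₁ = v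
  generalize (W.baseChange L).tateNine x₂ y₂ = w
  intro hf0 hf1 hq hfQ hD hj hf0' hf1' hfR hT
  have hfix : ∀ σ : L ≃ₐ[F] L,
      σ ((u ^ 3 - 6 * u ^ 2 + 3 * u + 1) / (u * (u - 1))) =
        (u ^ 3 - 6 * u ^ 2 + 3 * u + 1) / (u * (u - 1)) := by
    intro σ
    simp only [map_div₀, map_mul, map_add, map_sub, map_pow, map_one, map_ofNat]
    rcases hT σ with e | e | e
    · rw [e]
    · rw [e, hfQ]
      exact hauptmodul_nine_eq_of_double hf0 hf1
    · rw [e, hfR, hauptmodul_nine_eq_of_double hf0' hf1', hfQ]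
      exact hauptmodul_nine_eq_of_double hf0 hf1
  obtain ⟨g, hg⟩ := (InfiniteGalois.mem_range_algebraMap_iff_fixed _).mpr hfix
  obtain ⟨hH0, hjH⟩ := j_mul_hauptmodul_nine hf0 hf1 hq hD hj
  have hgη : algebraMap F L (g * (g ^ 2 + 9 * g + 27)) =
      (u ^ 3 - 6 * u ^ 2 + 3 * u + 1) / (u * (u - 1)) *
        (((u ^ 3 - 6 * u ^ 2 + 3 * u + 1) / (u * (u - 1))) ^ 2 +
          9 * ((u ^ 3 - 6 * u ^ 2 + 3 * u + 1) / (u * (u - 1))) + 27) := by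
    simp only [map_mul, map_add, map_pow, map_ofNat, hg]
  refine ⟨g, hg, ?_, ?_⟩
  · intro h0
    apply hH0
    rw [← hgη, h0, map_zero]
  · apply (algebraMap F L).injective
    have hjL : algebraMap F L W.j = (W.baseChange L).j := (W.map_j _).symm
    simp only [map_mul, map_add, map_pow, map_ofNat, hjL, hg]
    exact hjH

end Descent

/-! ### §4. A Galois-stable cyclic subgroup of order `27` -/

section TwentySeven

variable {L : Type u} [Field L] [Algebra F L]

/-- The Galois action on an affine point is coordinatewise. [folklore] -/
theorem galois_smul_some (σ : L ≃ₐ[F] L) {x y : L}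
    (h : (W.baseChange L).toAffine.Nonsingular x y) :
    ∃ h', σ • (Affine.Point.some x y h : (W.baseChange L).toAffine.Point) =
      .some (σ x) (σ y) h' := by
  have e : σ • (Affine.Point.some x y h : (W.baseChange L).toAffine.Point) =
      Affine.Point.map (σ : L →ₐ[F] L) (.some x y h) := rfl
  rw [Affine.Point.map_some] at e
  exact ⟨_, e⟩

/-- **A Galois-stable cyclic subgroup of order `27` gives an `F`-point of `X₀(27)`**
(characteristic `0`). Let `W/F` be an elliptic curve, `L/F` Galois and `P ∈ W(L)` a point of
order `27` with `Gal(L/F)`-stable `ℤP`. Put `Q = 3P`, `T = 9P`. Then the level-`9` Hauptmoduln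
`η = η(W, ℤQ) ∈ F` and `η' = η(W/⟨T⟩, ℤP̄) ∈ F` (`P̄` the image of `P` on Vélu's quotient
`W/⟨T⟩`, which is defined over `F` since `x(T) ∈ F`) satisfy
`j(W) · η(η² + 9η + 27) = (η + 3)³(η³ + 9η² + 27η + 3)³`, `η(η² + 9η + 27) ≠ 0` and the equation
`η'(η'² + 9η' + 27)(η² + 9η + 27) = η³` of `X₀(27)` (fibre product of the two degeneracy maps
`X₀(9) → X₀(3)` over the `j`-line-free level-`3` Hauptmodul: `t₃(W/⟨T⟩, ⟨3P̄⟩) =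
η'(η'² + 9η' + 27)` by `level_nine_three_smul` (T) on `W/⟨T⟩`, and `= η³/(η² + 9η + 27)` by
`level_nine_three_smul` (P) on `W`, as `3P̄` is the image of `Q`). The three-isogeny is
`WeierstrassCurve.IsVeluThreePair.pointHom` composed with the coordinate change `D`.
[cite: Maier2006, Table 4 (N = 9, 27)] -/
theorem exists_XZeroTwentySeven_of_torsion [IsGalois F L] [CharZero F] [W.IsElliptic]
    {P : (W.baseChange L).toAffine.Point} (h27 : addOrderOf P = 27)
    (hσ : ∀ σ : L ≃ₐ[F] L, σ • P ∈ AddSubgroup.zmultiples P) :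
    ∃ η η' : F, η * (η ^ 2 + 9 * η + 27) ≠ 0 ∧
      W.j * (η * (η ^ 2 + 9 * η + 27)) = (η + 3) ^ 3 * (η ^ 3 + 9 * η ^ 2 + 27 * η + 3) ^ 3 ∧
      η' * (η' ^ 2 + 9 * η' + 27) * (η ^ 2 + 9 * η + 27) = η ^ 3 := by
  haveI : (W.baseChange L).IsElliptic := by rw [baseChange]; infer_instance
  haveI : CharZero L := charZero_of_injective_algebraMap (algebraMap F L).injective
  -- order bookkeeping: `Q = 3P` has order `9`, `T = 9P = 3Q` has order `3`
  have h27P : (27 : ℕ) • P = 0 := h27 ▸ addOrderOf_nsmul_eq_zero P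
  have hmul : ∀ k : ℕ, k • P = 0 → 27 ∣ k := fun k hk => h27 ▸ addOrderOf_dvd_of_nsmul_eq_zero hk
  have hP0 : P ≠ 0 := fun e => by have := hmul 1 (by rw [one_nsmul, e]); omega
  have hQ9 : addOrderOf ((3 : ℕ) • P) = 9 := by
    rw [addOrderOf_nsmul_of_dvd (by norm_num) (by rw [h27]; norm_num), h27]
  have h9Q : (9 : ℕ) • ((3 : ℕ) • P) = 0 := hQ9 ▸ addOrderOf_nsmul_eq_zero _
  have h3Q : (3 : ℕ) • ((3 : ℕ) • P) ≠ 0 := fun e => by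
    rw [← mul_nsmul'] at e
    have := hmul _ e
    norm_num at this
  rcases P with _ | ⟨xP, yP, hP⟩
  · exact absurd rfl hP0
  obtain ⟨xQ, yQ, hQ, hQe⟩ : ∃ xQ yQ hQ, (3 : ℕ) • (Affine.Point.some _ _ hP :
      (W.baseChange L).toAffine.Point) = .some xQ yQ hQ := by
    rcases hQQ : (3 : ℕ) • (Affine.Point.some _ _ hP : (W.baseChange L).toAffine.Point) with
        _ | ⟨xQ, yQ, hQ⟩
    · exfalso
      apply h3Q
      rw [hQQ, ← Affine.Point.zero_def, nsmul_zero]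
    · exact ⟨xQ, yQ, hQ, rfl⟩
  rw [hQe] at hQ9 h9Q h3Q
  obtain ⟨x₃, y₃, h₃, hTe⟩ : ∃ x₃ y₃ h₃, (3 : ℕ) • (Affine.Point.some _ _ hQ :
      (W.baseChange L).toAffine.Point) = .some x₃ y₃ h₃ := by
    rcases hTT : (3 : ℕ) • (Affine.Point.some _ _ hQ : (W.baseChange L).toAffine.Point) with
        _ | ⟨x₃, y₃, h₃⟩
    · exact absurd (hTT.trans Affine.Point.zero_def.symm) h3Q
    · exact ⟨x₃, y₃, h₃, rfl⟩
  have e3Q : (Affine.Point.some _ _ hQ : (W.baseChange L).toAffine.Point) +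
      (.some _ _ hQ + .some _ _ hQ) = .some x₃ y₃ h₃ := by
    rw [← hTe]
    abel
  have h9Pe : (9 : ℕ) • (Affine.Point.some _ _ hP : (W.baseChange L).toAffine.Point) =
      .some x₃ y₃ h₃ := by
    rw [show (9 : ℕ) = 3 * 3 from rfl, mul_nsmul', hQe, hTe]
  have hT3 : (3 : ℕ) • (Affine.Point.some _ _ h₃ : (W.baseChange L).toAffine.Point) = 0 := by
    rw [← h9Pe, ← mul_nsmul']
    exact h27P
  have hT3' : addOrderOf (Affine.Point.some _ _ h₃ : (W.baseChange L).toAffine.Point) = 3 :=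
    addOrderOf_eq_prime hT3 (Affine.Point.some_ne_zero _)
  have hTT : (Affine.Point.some _ _ h₃ : (W.baseChange L).toAffine.Point) + .some _ _ h₃ =
      -.some _ _ h₃ := by
    rw [eq_neg_iff_add_eq_zero]
    have e : (Affine.Point.some _ _ h₃ : (W.baseChange L).toAffine.Point) + .some _ _ h₃ +
        .some _ _ h₃ = (3 : ℕ) • .some _ _ h₃ := by
      abel
    rw [e, hT3]
  -- Galois commutes with multiplication: `σ(kR) = k σR`
  have hσn : ∀ (σ : L ≃ₐ[F] L) (k : ℕ) (R : (W.baseChange L).toAffine.Point),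
      σ • (k • R) = k • (σ • R) := fun σ k R => by
    have e := map_nsmul (DistribSMul.toAddMonoidHom _ σ) k R
    simpa only [DistribSMul.toAddMonoidHom_apply] using e
  have hzn : ∀ (n : ℤ) (k : ℕ) (R : (W.baseChange L).toAffine.Point),
      k • (n • R) = n • (k • R) := fun n k R => by
    rw [← natCast_zsmul, ← natCast_zsmul, smul_smul, smul_smul, mul_comm]
  -- `x(T) ∈ F`
  have hfix : ∀ σ : L ≃ₐ[F] L, σ x₃ = x₃ := by
    intro σ
    obtain ⟨n, hn⟩ := AddSubgroup.mem_zmultiples_iff.mp (hσ σ)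
    have e9 : σ • (Affine.Point.some _ _ h₃ : (W.baseChange L).toAffine.Point) =
        n • (Affine.Point.some _ _ h₃ : (W.baseChange L).toAffine.Point) := by
      rw [← h9Pe, hσn, ← hn, hzn]
    have hmod := mod_addOrderOf_zsmul (Affine.Point.some _ _ h₃ : (W.baseChange L).toAffine.Point) n
    rw [hT3', ← e9] at hmod
    have h0n : 0 ≤ n % 3 := Int.emod_nonneg _ (by norm_num)
    have h3n : n % 3 < 3 := Int.emod_lt_of_pos _ (by norm_num)
    have coords : ∀ {x' y' : L} {h' : (W.baseChange L).toAffine.Nonsingular x' y'},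
        σ • (Affine.Point.some _ _ h₃ : (W.baseChange L).toAffine.Point) = .some _ _ h' →
          σ x₃ = x' := by
      intro x' y' h' hσP
      obtain ⟨h'', e⟩ := galois_smul_some (W := W) σ h₃
      rw [e] at hσP
      exact ((Affine.Point.some.injEq _ _ _ _ _ _).mp hσP).1
    generalize n % 3 = m at hmod h0n h3n
    interval_cases m
    · rw [zero_zsmul] at hmod
      exact absurd ((smul_eq_zero_iff_eq σ).mp hmod.symm) (Affine.Point.some_ne_zero _)
    · rw [one_zsmul] at hmod
      exact coords hmod.symm
    · rw [two_zsmul, hTT, Affine.Point.neg_some] at hmod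
      exact coords hmod.symm
  obtain ⟨x₀', hx₀'⟩ := (InfiniteGalois.mem_range_algebraMap_iff_fixed x₃).mpr hfix
  -- Vélu's data over `F`: `D_F = (1, x₀', -a₁/2, -(a₃ + a₁x₀')/2)`, `E₁ = D_F • W`, `E' = E₁/⟨T⟩`
  obtain ⟨DF, hDF⟩ : ∃ DF : VariableChange F, DF = ⟨1, x₀', -W.a₁ / 2, -(W.a₃ + W.a₁ * x₀') / 2⟩ :=
    ⟨_, rfl⟩
  obtain ⟨E', hE'⟩ : ∃ E' : WeierstrassCurve F, E' = ⟨0, (DF • W).a₂, 0, -9 * (DF • W).a₄,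
      -(27 * (DF • W).a₆ + 8 * (DF • W).a₂ * (DF • W).a₄)⟩ := ⟨_, rfl⟩
  obtain ⟨D, hDL⟩ : ∃ D : VariableChange L, D = DF.map (algebraMap F L) := ⟨_, rfl⟩
  have hD : D = ⟨1, x₃, -(W.baseChange L).a₁ / 2,
      -((W.baseChange L).a₃ + (W.baseChange L).a₁ * x₃) / 2⟩ := by
    rw [hDL, hDF]
    simp only [VariableChange.map]
    have ha₁ : (W.baseChange L).a₁ = algebraMap F L W.a₁ := rfl
    have ha₃ : (W.baseChange L).a₃ = algebraMap F L W.a₃ := rfl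
    rw [ha₁, ha₃, ← hx₀']
    simp only [map_div₀, map_neg, map_add, map_mul, map_ofNat, Units.map, map_one]
  have hW₁map : D • W.baseChange L = (DF • W).baseChange L := by
    rw [hDL]
    exact map_variableChange W DF (algebraMap F L)
  have hE : E'.baseChange L = ⟨0, (D • W.baseChange L).a₂, 0, -9 * (D • W.baseChange L).a₄,
      -(27 * (D • W.baseChange L).a₆ + 8 * (D • W.baseChange L).a₂ * (D • W.baseChange L).a₄)⟩ := by
    rw [hW₁map, hE']
    ext <;> simp [baseChange, map_ofNat]
  -- §2 at `Q` on `W_L`: the Vélu model and the degeneracy value at `Q`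
  obtain ⟨-, ⟨h1, h3', hx3, hs0, ha6, ha2⟩, ⟨hz, -, hdeg⟩⟩ :=
    level_nine_three_smul (V := W.baseChange L) h9Q h3Q e3Q hD rfl hE
  obtain ⟨s₀, hs₀⟩ : ∃ s₀, s₀ = D.toY x₃ y₃ := ⟨_, rfl⟩
  obtain ⟨m₀, hm₀⟩ : ∃ m₀, m₀ = (D • W.baseChange L).a₄ / (2 * s₀) := ⟨_, rfl⟩
  rw [← hs₀] at hs0 ha6 ha2
  rw [← hm₀] at ha2
  have hm : (D • W.baseChange L).a₄ = 2 * m₀ * s₀ := by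
    rw [hm₀, mul_comm (2 : L) (_ / _), mul_assoc,
      div_mul_cancel₀ _ (mul_ne_zero two_ne_zero hs0)]
  have hVelu : IsVeluThreePair m₀ s₀ (D • W.baseChange L) (E'.baseChange L) :=
    { a₁_eq := h1
      a₂_eq := ha2
      a₃_eq := h3'
      a₄_eq := hm
      a₆_eq := ha6
      a₁'_eq := by rw [hE]
      a₂'_eq := by rw [hE]; exact ha2
      a₃'_eq := by rw [hE]
      a₄'_eq := by
        rw [hE]
        show -9 * (D • W.baseChange L).a₄ = _
        rw [hm]
        ring
      a₆'_eq := by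
        rw [hE]
        show -(27 * (D • W.baseChange L).a₆ +
          8 * (D • W.baseChange L).a₂ * (D • W.baseChange L).a₄) = _
        rw [hm, ha6, ha2]
        ring
      Δ_ne := (D • W.baseChange L).isUnit_Δ.ne_zero }
  have hXform : ∀ z, hVelu.X z = (z ^ 3 + 2 * (D • W.baseChange L).a₄ * z +
      4 * (D • W.baseChange L).a₆) / z ^ 2 := fun z => by
    rw [hm, ha6]
    simp only [IsVeluThreePair.X]
    ring
  have hYform : ∀ z w, hVelu.Y z w = w * (z ^ 3 - 2 * (D • W.baseChange L).a₄ * z -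
      8 * (D • W.baseChange L).a₆) / z ^ 3 := fun z w => by
    rw [hm, ha6]
    simp only [IsVeluThreePair.Y]
    ring
  -- the composite `Ψ = (Vélu's 3-isogeny) ∘ D : W(L) → E'(L)`
  obtain ⟨Ψ, hΨ⟩ : ∃ Ψ : (W.baseChange L).toAffine.Point →+ (E'.baseChange L).toAffine.Point,
      Ψ = hVelu.pointHom.comp (VariableChange.pointEquiv (W.baseChange L) D).toAddMonoidHom :=
    ⟨_, rfl⟩
  have hΨsome : ∀ {x y : L} (hxy : (W.baseChange L).toAffine.Nonsingular x y),
      Ψ (.some x y hxy) = hVelu.pointFun (.some (D.toX x) (D.toY x y)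
        ((VariableChange.nonsingular_iff (W.baseChange L) D x y).mpr hxy)) := fun hxy => by
    rw [hΨ]
    rfl
  have hΨT : Ψ (.some x₃ y₃ h₃) = 0 := by rw [hΨsome, hVelu.pointFun_some_of_eq_zero _ hx3]
  -- `P̄ = Ψ P` has order `9`, `3P̄ = Ψ Q` is affine
  have h9Pb : (9 : ℕ) • Ψ (.some xP yP hP) = 0 := by rw [← map_nsmul, h9Pe, hΨT]
  have h3Pb : (3 : ℕ) • Ψ (.some xP yP hP) = .some (hVelu.X (D.toX xQ))
      (hVelu.Y (D.toX xQ) (D.toY xQ yQ)) (hVelu.nonsingular_image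
        ((VariableChange.nonsingular_iff (W.baseChange L) D xQ yQ).mpr hQ) hz) := by
    rw [← map_nsmul, hQe, hΨsome, hVelu.pointFun_some _ hz]
  have h3Pb0 : (3 : ℕ) • Ψ (.some xP yP hP) ≠ 0 := by
    rw [h3Pb]
    exact Affine.Point.some_ne_zero _
  have hPb9 : addOrderOf (Ψ (.some xP yP hP)) = 9 := by
    have e := addOrderOf_eq_prime_pow (p := 3) (n := 1) (x := Ψ (.some xP yP hP))
      (by rw [pow_one]; exact h3Pb0) (by rw [show 3 ^ (1 + 1) = 9 by norm_num]; exact h9Pb)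
    rw [e]
    norm_num
  -- `P̄` is affine: `x(P) ≠ x(T)` as `P ≠ ±T`
  have hzP : D.toX xP ≠ 0 := by
    intro e0
    have hx : xP = x₃ := by
      rw [hD, VariableChange.toX_def] at e0
      simpa [sub_eq_zero] using e0
    apply Affine.Point.some_ne_zero hQ
    rw [← hQe]
    rcases Affine.Y_eq_of_X_eq hP.1 h₃.1 hx with hy | hy
    · have e : (Affine.Point.some xP yP hP : (W.baseChange L).toAffine.Point) = .some x₃ y₃ h₃ :=
        (Affine.Point.some.injEq _ _ _ _ _ _).mpr ⟨hx, hy⟩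
      rw [e, hT3]
    · have e : (Affine.Point.some xP yP hP : (W.baseChange L).toAffine.Point) =
          -.some x₃ y₃ h₃ := by
        rw [Affine.Point.neg_some]
        exact (Affine.Point.some.injEq _ _ _ _ _ _).mpr ⟨hx, hy⟩
      rw [e, smul_neg, hT3, neg_zero]
  have hΨP : Ψ (.some xP yP hP) = .some (hVelu.X (D.toX xP)) (hVelu.Y (D.toX xP) (D.toY xP yP))
      (hVelu.nonsingular_image ((VariableChange.nonsingular_iff (W.baseChange L) D xP yP).mpr hP)
        hzP) := by
    rw [hΨsome, hVelu.pointFun_some _ hzP]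
  -- `Ψ` is Galois-equivariant (its coefficients `x(T), a₄(E₁), a₆(E₁)` lie in `F`)
  have hσa : ∀ σ : L ≃ₐ[F] L, σ (D • W.baseChange L).a₄ = (D • W.baseChange L).a₄ ∧
      σ (D • W.baseChange L).a₆ = (D • W.baseChange L).a₆ := fun σ => by
    rw [hW₁map]
    exact ⟨σ.commutes _, σ.commutes _⟩
  have hσD : ∀ (σ : L ≃ₐ[F] L) (x y : L),
      D.toX (σ x) = σ (D.toX x) ∧ D.toY (σ x) (σ y) = σ (D.toY x y) := by
    intro σ x y
    have e₁ : σ (W.baseChange L).a₁ = (W.baseChange L).a₁ := σ.commutes W.a₁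
    have e₃ : σ (W.baseChange L).a₃ = (W.baseChange L).a₃ := σ.commutes W.a₃
    rw [hD]
    refine ⟨?_, ?_⟩ <;>
      simp only [VariableChange.toX_def, VariableChange.toY_def, inv_one, Units.val_one, one_pow,
        one_mul, map_sub, map_mul, map_add, map_neg, map_div₀, map_ofNat, hfix σ, e₁, e₃]
  have hequiv : ∀ (σ : L ≃ₐ[F] L) (R : (W.baseChange L).toAffine.Point),
      σ • Ψ R = Ψ (σ • R) := by
    intro σ R
    rcases R with _ | ⟨x, y, hxy⟩
    · rw [← Affine.Point.zero_def, smul_zero, map_zero, smul_zero]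
    · obtain ⟨hxy', e⟩ := galois_smul_some (W := W) σ hxy
      rw [e, hΨsome, hΨsome]
      by_cases hx0 : D.toX x = 0
      · have hx0' : D.toX (σ x) = 0 := by rw [(hσD σ x y).1, hx0, map_zero]
        rw [hVelu.pointFun_some_of_eq_zero _ hx0, hVelu.pointFun_some_of_eq_zero _ hx0',
          smul_zero]
      · have hx0' : D.toX (σ x) ≠ 0 := by
          rw [(hσD σ x y).1]
          intro e0
          exact hx0 (σ.injective (by rw [e0, map_zero]))
        rw [hVelu.pointFun_some _ hx0, hVelu.pointFun_some _ hx0']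
        obtain ⟨h'', e'⟩ := galois_smul_some (W := E') σ (hVelu.nonsingular_image
          ((VariableChange.nonsingular_iff (W.baseChange L) D x y).mpr hxy) hx0)
        rw [e']
        refine (Affine.Point.some.injEq _ _ _ _ _ _).mpr ⟨?_, ?_⟩
        · rw [hXform, hXform, (hσD σ x y).1]
          simp only [map_div₀, map_add, map_mul, map_pow, map_ofNat, (hσa σ).1, (hσa σ).2]
        · rw [hYform, hYform, (hσD σ x y).1, (hσD σ x y).2]
          simp only [map_div₀, map_sub, map_mul, map_pow, map_ofNat, (hσa σ).1, (hσa σ).2]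
  have hσPb : ∀ σ : L ≃ₐ[F] L,
      σ • Ψ (.some xP yP hP) ∈ AddSubgroup.zmultiples (Ψ (.some xP yP hP)) := by
    intro σ
    obtain ⟨n, hn⟩ := AddSubgroup.mem_zmultiples_iff.mp (hσ σ)
    exact AddSubgroup.mem_zmultiples_iff.mpr ⟨n, by rw [hequiv, ← hn, map_zsmul]⟩
  have hσQ : ∀ σ : L ≃ₐ[F] L, σ • (Affine.Point.some xQ yQ hQ : (W.baseChange L).toAffine.Point) ∈
      AddSubgroup.zmultiples (Affine.Point.some xQ yQ hQ : (W.baseChange L).toAffine.Point) := by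
    intro σ
    obtain ⟨n, hn⟩ := AddSubgroup.mem_zmultiples_iff.mp (hσ σ)
    refine AddSubgroup.mem_zmultiples_iff.mpr ⟨n, ?_⟩
    rw [← hQe, hσn, ← hn, hzn]
  -- `E'` is an elliptic curve over `F`
  haveI hE'ell : E'.IsElliptic := by
    refine ⟨?_⟩
    have hΔ := hVelu.Δ'_ne
    rw [baseChange, map_Δ] at hΔ
    exact isUnit_iff_ne_zero.mpr fun e => hΔ (by rw [e, map_zero])
  -- Klein–Fricke at level 9 for `(W, ℤQ)` and `(E', ℤP̄)`
  obtain ⟨xB, yB, hB, hBe⟩ : ∃ xB yB, ∃ hB : (E'.baseChange L).toAffine.Nonsingular xB yB,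
      Ψ (.some xP yP hP) = .some xB yB hB := ⟨_, _, _, hΨP⟩
  rw [hBe] at hPb9 hσPb h3Pb h3Pb0 h9Pb
  obtain ⟨η', hη'L, -, -⟩ := exists_hauptmodul_nine_eq_of_torsion (W := E') hPb9 hσPb
  obtain ⟨η, hηL, hη0, hjη⟩ := exists_hauptmodul_nine_eq_of_torsion (W := W) hQ9 hσQ
  -- compatibility at `P̄` on `E'`: `t₃(E'/⟨3P̄⟩… ) = η'(η'² + 9η' + 27)` at the point `3P̄ = Ψ Q`
  have e3B : (Affine.Point.some xB yB hB : (E'.baseChange L).toAffine.Point) +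
      (.some xB yB hB + .some xB yB hB) = .some (hVelu.X (D.toX xQ))
        (hVelu.Y (D.toX xQ) (D.toY xQ yQ)) (hVelu.nonsingular_image
          ((VariableChange.nonsingular_iff (W.baseChange L) D xQ yQ).mpr hQ) hz) := by
    rw [← h3Pb]
    abel
  obtain ⟨⟨-, hcompat⟩, -, -⟩ :=
    level_nine_three_smul (V := E'.baseChange L) h9Pb h3Pb0 e3B rfl rfl rfl
  rw [hXform, hYform] at hcompat
  have key := hcompat.symm.trans hdeg
  rw [← hη'L, ← hηL] at key
  have key' : algebraMap F L (η' * (η' ^ 2 + 9 * η' + 27)) =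
      algebraMap F L (η ^ 3 / (η ^ 2 + 9 * η + 27)) := by
    simp only [map_mul, map_add, map_pow, map_div₀, map_ofNat]
    exact key
  have keyF := (algebraMap F L).injective key'
  have hden : η ^ 2 + 9 * η + 27 ≠ 0 := fun e => hη0 (by rw [e, mul_zero])
  rw [eq_div_iff hden] at keyF
  exact ⟨η, η', hη0, hjη, keyF⟩

/-- **A rational cyclic `27`-isogeny gives a rational point of `X₀(27)`** (characteristic `0`):
if the elliptic curve `V/K` admits a `K`-rational isogeny with cyclic kernel of order `27`, there
are `η, η' ∈ K` with `η(η² + 9η + 27) ≠ 0`, `j(V) · η(η² + 9η + 27) = (η + 3)³(η³ + 9η² + 27η + 3)³`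
and `η'(η'² + 9η' + 27)(η² + 9η + 27) = η³` (apply `exists_XZeroTwentySeven_of_torsion` to a
generator of the kernel, `L = K̄`). [cite: Maier2006, Table 4 (N = 27)] -/
theorem Isogeny.exists_XZeroTwentySeven_of_isCyclic {K : Type u} [Field K] [CharZero K]
    {V V' : WeierstrassCurve K} [V.IsElliptic] (ψ : Isogeny V V') (hψ : ψ.IsCyclic)
    (hdeg : ψ.degree = 27) :
    ∃ η η' : K, η * (η ^ 2 + 9 * η + 27) ≠ 0 ∧
      V.j * (η * (η ^ 2 + 9 * η + 27)) = (η + 3) ^ 3 * (η ^ 3 + 9 * η ^ 2 + 27 * η + 3) ^ 3 ∧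
      η' * (η' ^ 2 + 9 * η' + 27) * (η ^ 2 + 9 * η + 27) = η ^ 3 := by
  haveI : IsGalois K (AlgebraicClosure K) := {}
  haveI : IsAddCyclic ψ.toAddMonoidHom.ker := hψ
  obtain ⟨g, hg⟩ := IsAddCyclic.exists_ofOrder_eq_natCard (α := ψ.toAddMonoidHom.ker)
  have hordP : addOrderOf (g : V.geomPoints) = 27 := by
    rw [AddSubgroup.addOrderOf_coe, hg]
    exact hdeg
  have hgen : AddSubgroup.zmultiples (g : V.geomPoints) = ψ.toAddMonoidHom.ker := by
    apply AddSubgroup.eq_of_le_of_card_ge (AddSubgroup.zmultiples_le.mpr g.2)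
    rw [Nat.card_zmultiples, hordP]
    exact hdeg.le
  have hg0 : ψ (g : V.geomPoints) = 0 := (AddMonoidHom.mem_ker).mp g.2
  have hst : ∀ σ : Field.absoluteGaloisGroup K,
      σ • (g : V.geomPoints) ∈ AddSubgroup.zmultiples (g : V.geomPoints) := fun σ => by
    rw [hgen, AddMonoidHom.mem_ker, Isogeny.coe_toAddMonoidHom, ψ.map_smul, hg0, smul_zero]
  exact exists_XZeroTwentySeven_of_torsion (W := V) (L := AlgebraicClosure K)
    (P := (g : V.geomPoints)) hordP hst

/-- **Kenku, level `27`: a rational cyclic `27`-isogeny forces `j = -2¹⁵·3·5³`.** If an elliptic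
curve `V/ℚ` admits a `ℚ`-rational isogeny with cyclic kernel of order `27`, then
`j(V) = -12288000` (the CM curve `27a2`/`27a4`, discriminant `-27`): the point `(η, η')` of
`X₀(27) : η'(η'² + 9η' + 27)(η² + 9η + 27) = η³` furnished by
`Isogeny.exists_XZeroTwentySeven_of_isCyclic` is `(-9, -3)` by Euler's case `n = 3` of Fermat
(`Literature.NumberTheory.EllipticCurves.XZeroTwentySeven.rat_point_eq`, via Mathlib's
`fermatLastTheoremThree`), and `R₉(-9) = -12288000`. This is the level-`27` entry of the table of
rational cyclic isogenies (Kenku, *J. London Math. Soc.* (2) 23 (1981), 415–427, via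
Ligozat's determination of `X₀(27)(ℚ)`), here with a modular-curve-free proof.
[cite: Maier2006, Table 4 (N = 9, 27)] -/
theorem Isogeny.j_eq_of_isCyclic_degree_twentySeven {V V' : WeierstrassCurve ℚ} [V.IsElliptic]
    (ψ : Isogeny V V') (hψ : ψ.IsCyclic) (hdeg : ψ.degree = 27) : V.j = -12288000 := by
  obtain ⟨η, η', hη0, hj, hX⟩ := ψ.exists_XZeroTwentySeven_of_isCyclic hψ hdeg
  have hη : η ≠ 0 := fun e => hη0 (by rw [e, zero_mul])
  obtain ⟨-, hη9⟩ := Literature.NumberTheory.EllipticCurves.XZeroTwentySeven.rat_point_eq hη hX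
  exact Literature.NumberTheory.EllipticCurves.XZeroTwentySeven.j_eq_of_eta_eq hη9 hj

end TwentySeven

end WeierstrassCurve
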